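import Summits.ValiantsHypothesis.ValiantsHypothesis.Theorems.BarrierLeverAnchoredDoorHitsLowerPairsApexLemma

/-!
# Support item `AnchoredDoorHitsLowerPairs` (stmt-ValiantsHypothesis-22510), line `anchored-peeling`:
# THE TYPED APEX SPECIALISATION — apex `v⋆ ↦ x_n`, TAIL vertices `D''(1 + x_n)`, ROOT vertices `D'' + x_n`, and the column readings

Helper file (`--supports stmt-ValiantsHypothesis-22510`; cell valiant-natproofs, rung V4, 𝒟-side door (c); registered line
`Cruxes/AnchoredDoorHitsLowerPairs/Lines/anchored_peeling.lean` v17/v18, registered residual `Stmt.stub_apexRest`; prover seat val-np-p1 gen 22;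
memo HOME/val-np-p1/g22/MEMO-relapex-valnp1-g22.md). Closes NO item. Sequel: `…RelApexLemma` (the typed RELATIVE Apex Lemma) and `…RelApexRecursion`.

THE SPECIALISATION (`apexThetaT`, `apexPhiT`; memo g21 §11 «vertex types»). Variables `X' ⊔ {n}`; the apex vertex `v⋆` gets the door `x_n`; a vertex of the
TAIL set `G₁` gets the `x_n`-tail of weight `1` on each of its roots (`D_γ = D''_γ·(1 + x_n)`); a vertex of the ROOT set `G₂` gets the extra root `n` with
weight `1` and no tails (`D_γ = D''_γ + x_n`); both at once give `D''_γ(1 + x_n) + x_n`; all other doors are `x_n`-free (`doorElem_apexT_of_ne`). Then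
(`coeff_prod_doorElem_apexT_notMem` / `_mem`; `prod_add_X_mul` is the expansion of `∏(A_γ + x_n B_γ)` modulo `x_n²`): a column `W ∌ v⋆` reads
`[x^U] D''^W` on `U ∌ n` and `|W ∩ G₁|·[x^{U∖n}] D''^W + Σ_{γ ∈ W ∩ G₂} [x^{U∖n}] D''^{W∖γ}` on `U ∋ n` — bottom LABELS `W` and `W ∖ γ`; a column `W ∋ v⋆`
reads `0` on `U ∌ n` and `[x^{U∖n}] D''^{W∖v⋆}` on `U ∋ n`. Move A of `…ApexLemma` is the case `G₂ = ∅`.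

WHAT THIS IS NOT: calculus only; nothing on crux stmt-ValiantsHypothesis-14610 or on `VP` versus `VNP`.
-/

set_option linter.dupNamespace false

namespace Summit.ValiantsHypothesis.ValiantsHypothesis.Theorems.BarrierLever.AnchoredPeeling

open Finset MvPolynomial
open Summit.ValiantsHypothesis.ValiantsHypothesis.Theorems.BarrierLever.BrickCalculus (pexpo pexpo_def pexpo_le_iff pexpo_sub
  pexpo_apply_castAdd pexpo_apply_natAdd)

noncomputable section

variable {h : ℕ}

/-! ## 1. `x_a`-free bookkeeping and the product expansion modulo `x_a²` -/

/-- **Reading `P + x_a·Q + x_a²·R'`** with `P` free of `x_a`: the face `U` reads `Q` at `U ∖ a` if `a ∈ U`, else `P` at `U`. -/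
theorem coeff_pexpo_add_X_mul_add_sq {a : Fin h} {P : MvPolynomial (Fin (h + h)) ℂ} (hP : XFree a P)
    (Q R' : MvPolynomial (Fin (h + h)) ℂ) (U : Finset (Fin h)) :
    coeff (pexpo U ∅) (P + X (Fin.castAdd h a) * Q + X (Fin.castAdd h a) ^ 2 * R') =
      if a ∈ U then coeff (pexpo (U.erase a) ∅) Q else coeff (pexpo U ∅) P := by
  rw [coeff_add, coeff_add, coeff_pexpo_X_sq_mul, add_zero, coeff_pexpo_X_mul]
  by_cases ha : a ∈ U
  · rw [if_pos ha, if_pos ha, coeff_pexpo_eq_zero_of_xFree hP ∅ ha, zero_add]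
  · rw [if_neg ha, if_neg ha, add_zero]

/-- **Product expansion modulo `x_a²`:** `∏_{γ∈W} (A_γ + x_a B_γ) = ∏ A + x_a · Σ_γ B_γ ∏_{δ ≠ γ} A_δ + x_a² · (rest)`. -/
theorem prod_add_X_mul (a : Fin h) (A B : Fin h → MvPolynomial (Fin (h + h)) ℂ) (W : Finset (Fin h)) :
    ∃ R' : MvPolynomial (Fin (h + h)) ℂ,
      ∏ γ ∈ W, (A γ + X (Fin.castAdd h a) * B γ) =
        ∏ γ ∈ W, A γ + X (Fin.castAdd h a) * (∑ γ ∈ W, B γ * ∏ δ ∈ W.erase γ, A δ) + X (Fin.castAdd h a) ^ 2 * R' := by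
  classical
  induction W using Finset.induction_on with
  | empty => exact ⟨0, by simp⟩
  | insert γ₀ W hγ₀ ih =>
    obtain ⟨R', hR'⟩ := ih
    refine ⟨(A γ₀ + X (Fin.castAdd h a) * B γ₀) * R' + B γ₀ * (∑ γ ∈ W, B γ * ∏ δ ∈ W.erase γ, A δ), ?_⟩
    rw [Finset.prod_insert hγ₀, Finset.prod_insert hγ₀, Finset.sum_insert hγ₀, hR', Finset.erase_insert hγ₀]
    have hins : ∀ γ ∈ W, ∏ δ ∈ (insert γ₀ W).erase γ, A δ = A γ₀ * ∏ δ ∈ W.erase γ, A δ := by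
      intro γ hγ
      rw [Finset.erase_insert_of_ne (fun heq => hγ₀ (by rw [heq]; exact hγ)),
        Finset.prod_insert (fun hmem => hγ₀ (Finset.mem_of_mem_erase hmem))]
    have hS : ∑ γ ∈ W, B γ * ∏ δ ∈ (insert γ₀ W).erase γ, A δ = A γ₀ * ∑ γ ∈ W, B γ * ∏ δ ∈ W.erase γ, A δ := by
      rw [Finset.mul_sum]
      exact Finset.sum_congr rfl (fun γ hγ => by rw [hins γ hγ]; ring)
    rw [hS]
    ring

/-! ## 2. The typed apex specialisation of the doors -/

section ApexT

variable (θ'' : Fin h → Fin h → ℂ) (φ'' : Fin h → Fin h → Fin h → ℂ) (vs n : Fin h) (G₁ G₂ : Finset (Fin h))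

/-- The root indicator `r_γ = [γ ∈ G₂]`. -/
def rootInd : Fin h → ℂ := fun γ => if γ ∈ G₂ then 1 else 0

/-- Typed apex root weights: the apex `v⋆` has the single root `n` (weight `1`); a ROOT vertex (`γ ∈ G₂`) gets the extra root `n` with weight `1`;
all other roots are those of `θ''` off `n`. -/
def apexThetaT : Fin h → Fin h → ℂ :=
  fun b γ => if γ = vs then (if b = n then 1 else 0) else (if b = n then rootInd G₂ γ else θ'' b γ)

/-- Typed apex tail weights: the apex has no tails; a TAIL vertex (`γ ∈ G₁`) gets the `x_n`-tail `1` on its roots off `n`; the root `n` of a ROOT vertex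
carries no tails; all other tails are those of `φ''` off `n`. -/
def apexPhiT : Fin h → Fin h → Fin h → ℂ :=
  fun b γ b' => if γ = vs then 0 else (if b' = n then tailInd G₁ γ else (if b = n then 0 else φ'' b γ b'))

variable {θ'' φ'' vs n G₁ G₂}

/-- **The apex door is `x_n`.** -/
theorem doorElem_apexT_self : doorElem (apexThetaT θ'' vs n G₂) (apexPhiT φ'' vs n G₁) vs = X (Fin.castAdd h n) := by
  classical
  rw [doorElem, Finset.sum_eq_single n]
  · rw [cfacCore]
    simp only [apexThetaT, apexPhiT, if_true, C_1, C_0, zero_mul, add_zero, Finset.prod_const_one, mul_one]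
    rw [pexpo_singleton_empty]; rfl
  · intro b _ hb
    rw [cfacCore]
    simp only [apexThetaT, if_true, if_neg hb, C_0, zero_mul, mul_zero]
  · intro hn; exact absurd (Finset.mem_univ n) hn

/-- Core factors off the apex and off the root `n`: `cfacCore(spec) b = cfacCore('') b · (1 + c_γ x_n)`. -/
theorem cfacCore_apexT_of_ne {γ : Fin h} (hγ : γ ≠ vs) (hφ : ∀ b, φ'' b γ n = 0) {b : Fin h} (hb : b ≠ n) :
    cfacCore (fun b => apexThetaT θ'' vs n G₂ b γ) (fun b b' => apexPhiT φ'' vs n G₁ b γ b') b =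
      cfacCore (fun b => θ'' b γ) (fun b b' => φ'' b γ b') b * (1 + C (tailInd G₁ γ) * X (Fin.castAdd h n)) := by
  classical
  rw [cfacCore, cfacCore]
  have hsplit : ∀ (ψ : Fin h → ℂ), (∏ b' ∈ (univ \ {b} : Finset (Fin h)), (1 + C (ψ b') * X (Fin.castAdd h b')) : MvPolynomial (Fin (h + h)) ℂ) =
      (1 + C (ψ n) * X (Fin.castAdd h n)) * ∏ b' ∈ ((univ \ {b} : Finset (Fin h))).erase n, (1 + C (ψ b') * X (Fin.castAdd h b')) := by
    intro ψ
    have hn : n ∈ (univ \ {b} : Finset (Fin h)) := by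
      rw [Finset.mem_sdiff, Finset.mem_singleton]; exact ⟨Finset.mem_univ n, fun h' => hb h'.symm⟩
    exact (Finset.mul_prod_erase _ _ hn).symm
  rw [hsplit (fun b' => apexPhiT φ'' vs n G₁ b γ b'), hsplit (fun b' => φ'' b γ b')]
  have hrest : (∏ b' ∈ ((univ \ {b} : Finset (Fin h))).erase n, (1 + C (apexPhiT φ'' vs n G₁ b γ b') * X (Fin.castAdd h b')) :
      MvPolynomial (Fin (h + h)) ℂ) = ∏ b' ∈ ((univ \ {b} : Finset (Fin h))).erase n, (1 + C (φ'' b γ b') * X (Fin.castAdd h b')) :=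
    Finset.prod_congr rfl (fun b' hb' => by
      rw [apexPhiT]; simp only [if_neg hγ, if_neg (Finset.ne_of_mem_erase hb'), if_neg hb])
  rw [hrest]
  simp only [apexThetaT, apexPhiT, if_neg hγ, if_neg hb, if_true, hφ b, C_0, zero_mul, add_zero, one_mul]
  ring

/-- The core factor of the extra root `n` of a non-apex vertex is `r_γ · x_n` (no tails). -/
theorem cfacCore_apexT_root {γ : Fin h} (hγ : γ ≠ vs) :
    cfacCore (fun b => apexThetaT θ'' vs n G₂ b γ) (fun b b' => apexPhiT φ'' vs n G₁ b γ b') n = C (rootInd G₂ γ) * X (Fin.castAdd h n) := by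
  classical
  rw [cfacCore]
  have h1 : (∏ b' ∈ (univ \ {n} : Finset (Fin h)), (1 + C (apexPhiT φ'' vs n G₁ n γ b') * X (Fin.castAdd h b')) :
      MvPolynomial (Fin (h + h)) ℂ) = 1 :=
    Finset.prod_eq_one (fun b' hb' => by
      have hb'n : b' ≠ n := by
        rw [Finset.mem_sdiff, Finset.mem_singleton] at hb'; exact hb'.2
      rw [apexPhiT]; simp only [if_neg hγ, if_neg hb'n, if_true, C_0, zero_mul, add_zero])
  rw [h1, mul_one, pexpo_singleton_empty, apexThetaT]
  simp only [if_neg hγ, if_true]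
  rw [mul_comm]; rfl

/-- The core factor at `n` of an `x_n`-rootless door vanishes. -/
theorem cfacCore_eq_zero_of_theta {γ : Fin h} (hθ : θ'' n γ = 0) :
    cfacCore (fun b => θ'' b γ) (fun b b' => φ'' b γ b') n = 0 := by
  rw [cfacCore]; simp only [hθ, C_0, zero_mul, mul_zero]

/-- **Doors off the apex: `D_γ = D''_γ · (1 + c_γ x_n) + r_γ x_n`** (`c` = tail indicator, `r` = root indicator). -/
theorem doorElem_apexT_of_ne {γ : Fin h} (hγ : γ ≠ vs) (hθ : θ'' n γ = 0) (hφ : ∀ b, φ'' b γ n = 0) :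
    doorElem (apexThetaT θ'' vs n G₂) (apexPhiT φ'' vs n G₁) γ =
      doorElem θ'' φ'' γ * (1 + C (tailInd G₁ γ) * X (Fin.castAdd h n)) + C (rootInd G₂ γ) * X (Fin.castAdd h n) := by
  classical
  rw [doorElem, doorElem, ← Finset.add_sum_erase _ _ (Finset.mem_univ n),
    ← Finset.add_sum_erase Finset.univ (fun b => cfacCore (fun b => θ'' b γ) (fun b b' => φ'' b γ b') b) (Finset.mem_univ n),
    cfacCore_apexT_root hγ, cfacCore_eq_zero_of_theta hθ, zero_add, Finset.sum_mul,
    Finset.sum_congr rfl (fun b hb => cfacCore_apexT_of_ne hγ hφ (Finset.ne_of_mem_erase hb))]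
  ring

/-- **Column of a family member avoiding the apex**: `t_W` on rows `U ∌ n`; `|W ∩ G₁|·t_W + Σ_{γ∈W∩G₂} t_{W∖γ}` (read at `U ∖ n`) on rows `U ∋ n`. -/
theorem coeff_prod_doorElem_apexT_notMem {W : Finset (Fin h)} (hW : vs ∉ W) (hθ : ∀ γ, θ'' n γ = 0) (hφ : ∀ b γ, φ'' b γ n = 0)
    (U : Finset (Fin h)) :
    coeff (pexpo U ∅) (∏ γ ∈ W, doorElem (apexThetaT θ'' vs n G₂) (apexPhiT φ'' vs n G₁) γ) =
      if n ∈ U then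
        (∑ γ ∈ W, tailInd G₁ γ) * coeff (pexpo (U.erase n) ∅) (∏ γ ∈ W, doorElem θ'' φ'' γ) +
          ∑ γ ∈ W, rootInd G₂ γ * coeff (pexpo (U.erase n) ∅) (∏ δ ∈ W.erase γ, doorElem θ'' φ'' δ)
      else coeff (pexpo U ∅) (∏ γ ∈ W, doorElem θ'' φ'' γ) := by
  classical
  set A : Fin h → MvPolynomial (Fin (h + h)) ℂ := fun γ => doorElem θ'' φ'' γ with hA
  set B : Fin h → MvPolynomial (Fin (h + h)) ℂ := fun γ => C (tailInd G₁ γ) * doorElem θ'' φ'' γ + C (rootInd G₂ γ) with hB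
  have hfac : ∀ γ ∈ W, doorElem (apexThetaT θ'' vs n G₂) (apexPhiT φ'' vs n G₁) γ = A γ + X (Fin.castAdd h n) * B γ := by
    intro γ hγ
    rw [doorElem_apexT_of_ne (fun heq => hW (by rw [← heq]; exact hγ)) (hθ γ) (fun b => hφ b γ), hA, hB]
    ring
  rw [Finset.prod_congr rfl hfac]
  obtain ⟨R', hR'⟩ := prod_add_X_mul n A B W
  have hAfree : ∀ γ, XFree n (A γ) := fun γ => xFree_doorElem (hθ γ) (fun b => hφ b γ)
  have hPfree : XFree n (∏ γ ∈ W, A γ) := xFree_prod W A (fun γ _ => hAfree γ)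
  rw [hR', coeff_pexpo_add_X_mul_add_sq hPfree]
  by_cases hn : n ∈ U
  · rw [if_pos hn, if_pos hn, coeff_sum, Finset.sum_mul, ← Finset.sum_add_distrib]
    refine Finset.sum_congr rfl (fun γ hγ => ?_)
    rw [hB]
    simp only
    rw [add_mul, mul_assoc, Finset.mul_prod_erase W A hγ, coeff_add, coeff_C_mul, coeff_C_mul]
  · rw [if_neg hn, if_neg hn]

/-- **Column of a family member through the apex**: `0` on rows `U ∌ n`, `t_{W∖v⋆}` (read at `U ∖ n`) on rows `U ∋ n`. -/
theorem coeff_prod_doorElem_apexT_mem {W : Finset (Fin h)} (hW : vs ∈ W) (hθ : ∀ γ, θ'' n γ = 0) (hφ : ∀ b γ, φ'' b γ n = 0)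
    (U : Finset (Fin h)) :
    coeff (pexpo U ∅) (∏ γ ∈ W, doorElem (apexThetaT θ'' vs n G₂) (apexPhiT φ'' vs n G₁) γ) =
      if n ∈ U then coeff (pexpo (U.erase n) ∅) (∏ γ ∈ W.erase vs, doorElem θ'' φ'' γ) else 0 := by
  classical
  rw [← Finset.mul_prod_erase W _ hW, doorElem_apexT_self, coeff_pexpo_X_mul]
  by_cases hn : n ∈ U
  · rw [if_pos hn, if_pos hn, coeff_prod_doorElem_apexT_notMem (Finset.notMem_erase vs W) hθ hφ, if_neg (Finset.notMem_erase n U)]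
  · rw [if_neg hn, if_neg hn]

/-- `Σ_{γ∈Y} c_γ = |Y ∩ G₁|`. -/
theorem sum_tailInd_eq_card (Y : Finset (Fin h)) : ∑ γ ∈ Y, tailInd G₁ γ = ((Y ∩ G₁).card : ℂ) := by
  classical
  simp only [tailInd]
  rw [Finset.sum_boole, Finset.filter_mem_eq_inter]

/-- `Σ_{γ∈Y} c_γ ≠ 0 ↔ Y` meets `G₁`. -/
theorem sum_tailInd_ne_zero_iff (Y : Finset (Fin h)) : (∑ γ ∈ Y, tailInd G₁ γ) ≠ 0 ↔ (Y ∩ G₁).Nonempty := by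
  rw [sum_tailInd_eq_card, Nat.cast_ne_zero, Finset.card_ne_zero]

end ApexT

end

end Summit.ValiantsHypothesis.ValiantsHypothesis.Theorems.BarrierLever.AnchoredPeeling
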